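import Literature.Probability.Percolation.QuadCrossingNoiseDiscrete
import Literature.Probability.Percolation.QuadCrossingContinuityEventsProofs
import Literature.Probability.Percolation.LatticePathArcs
import HarnessLib

/-!
# Connected crossings are path crossings: the crossing event of a conformal rectangle inside `ℋ_ℂ`

Topic `Probability/Percolation`; a bridge between the two renderings of quad crossings by bond
percolation on `δℤ²` that the tree carries:

* DKKMO's / G02's event `quadCrossing R δ` (`QuadCrossingRotationInvariance.lean`): the quad is a
  `ConformalRectangle` `R` (Jordan domain with four marked boundary points) and `ω` crosses it if
  some point of `R.arc 0` is JOINED BY A PATH inside `closure R.carrier ∩ openEdgeUnion δ ω` to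
  some point of `R.arc 2`;
* Schramm–Smirnov's encoding `S_ω = z2QuadConfig univ δ ω ∈ ℋ_ℂ` (`QuadCrossingSpaceZ2.lean`): the
  closure of the set of parametrised quads `Q ∈ 𝒬_ℂ` having a crossing — a CONNECTED COMPACT
  subset of `[Q]` meeting `∂₀Q` and `∂₂Q` — inside `openEdgeUnion δ ω`, and the crossing events
  `⊞_Q = {S : Q ∈ S}`.

Source for the identification: O. Schramm, S. Smirnov, *On the scaling limits of planar
percolation*, Ann. Probab. 39 (2011), §1.3: "A crossing of `Q` is a connected compact subset of
`[Q]` that intersects both opposite sides … in the discrete setting there is no difference between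
connected and path-connected crossings". We prove exactly this for the drawn open edges of `δℤ²`,
for an arbitrary containing set `C` (here the closed quad, whose boundary may cut the lattice
segments into infinitely many pieces):

* `joinedIn_inter_openEdgeUnion_of_isConnected` — a compact connected `K ⊆ C ∩ openEdgeUnion δ ω`
  (`δ > 0`) has all its points pairwise joined by paths inside `C ∩ openEdgeUnion δ ω`. Proof:
  either `K` lies in one open edge segment, where it is an interval
  (`segment_subset_of_isPreconnected_subset_segment`); or every point of `K` interior to a drawn
  open edge `[δx, δy]` has `[δx, k] ⊆ K` or `[k, δy] ⊆ K` (`segment_subset_or_segment_subset`: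
  otherwise two missing points cut `K`, using that distinct lattice edges meet only at common ends,
  `exists_eq_meshPoint_of_mem_segment_inter`, and that only finitely many open edges are drawn
  through `K`, `edgePairs_finite`), so the finitely many closed pieces
  `{z ∈ [δx, δy] : [δx, z] ⊆ K}` cover `K`, each joined through its anchor, and a chaining lemma
  along finite closed covers of connected sets (`joinedIn_of_finite_closed_cover`) concludes.
* The bridge, for a quad `Q ∈ 𝒬_ℂ` with `[Q] = closure R.carrier`, `∂₀Q = R.arc 0`,
  `∂₂Q = R.arc 2` (such a `Q` exists for every `R` by the square models of
  `QuadCrossingSquareModel.lean`): `quadCrossing R δ ⊆ {ω : Q ∈ S_ω}`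
  (`quadCrossing_subset_setOf_mem_z2QuadConfig`) and, for every `Q₁` with `Q < Q₁` in
  Schramm–Smirnov's order, `{ω : Q₁ ∈ S_ω} ⊆ quadCrossing R δ`
  (`setOf_mem_z2QuadConfig_subset_quadCrossing`, through `Quad.exists_isCrossing_of_mem_closure`);
  and the same two inclusions for the rotated quad `e^{-iα}R` against the rotated configuration
  `e^{iα} · S_ω` (`quadCrossing_rotateQuad_neg_subset`, `subset_quadCrossing_rotateQuad_neg`), which
  is how "`ω'` drawn on `e^{iα}δℤ²` crosses `Q`" is read in DKKMO's Theorem 1.2 / Cor. 1.3.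

Everything is proved; no named fact is introduced. This is groundwork for deriving
`dkkmo_crossing_rotation_invariance` (DKKMO Cor. 1.3, `q = 1`) from the Schramm–Smirnov half of
DKKMO's Theorem 1.2 and the continuity of the crossing events in `ℋ` (Schramm–Smirnov, Lemma 5.1).

## References

* O. Schramm, S. Smirnov, Ann. Probab. 39 (2011) 1768–1814, arXiv:1101.5820, §1.3.
  [SchrammSmirnov2011]
* H. Duminil-Copin, K. K. Kozlowski, D. Krachun, I. Manolescu, M. Oulamara, arXiv:2012.11672v1,
  Thm. 1.2, Cor. 1.3. [DKKMO2020Rotational]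
-/

noncomputable section

open Set Metric
open _root_.Topology
open scoped ComplexConjugate
open Literature.Probability.LatticeModels Literature.Probability.RandomPlanarGeometry

namespace Literature.Probability.Percolation

/-! ### Joining points along a finite closed cover of a connected set -/

/-- **Chaining along a finite closed cover.** Let `K ⊆ F` be preconnected and covered by finitely
many closed sets `T i` such that any two points of `K ∩ T i` are joined by a path in `F`. Then any
two points of `K` are joined by a path in `F`: the set of points of `K` joined to `a` and its
complement in `K` are both relatively open (a point `k` has the relatively open neighbourhood
`K ∖ ⋃ {T i : k ∉ T i}`, all of whose points share a `T i` with `k`), so the first is all of `K`.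
[folklore] -/
theorem joinedIn_of_finite_closed_cover {X : Type*} [TopologicalSpace X]
    {ι : Type*} [Finite ι] {K F : Set X} (hK : IsPreconnected K) (T : ι → Set X)
    (hT : ∀ i, IsClosed (T i)) (hcover : K ⊆ ⋃ i, T i) (hKF : K ⊆ F)
    (hjoin : ∀ i, ∀ x ∈ K ∩ T i, ∀ y ∈ K ∩ T i, JoinedIn F x y) {a b : X} (ha : a ∈ K)
    (hb : b ∈ K) : JoinedIn F a b := by
  classical
  -- the relatively open neighbourhood of `k` made of points sharing all their pieces with `k`
  set N : X → Set X := fun k => ⋂ i ∈ {i | k ∉ T i}, (T i)ᶜ with hN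
  have hNo : ∀ k, IsOpen (N k) := fun k =>
    (Set.toFinite _).isOpen_biInter fun i _ => (hT i).isOpen_compl
  have hkN : ∀ k, k ∈ N k := fun k => mem_iInter₂.2 fun i hi => hi
  have hjoinN : ∀ k ∈ K, ∀ k' ∈ K, k' ∈ N k → JoinedIn F k k' := by
    intro k hk k' hk' hkk'
    obtain ⟨i, hi⟩ := mem_iUnion.1 (hcover hk')
    have hki : k ∈ T i := by
      by_contra h
      exact (mem_iInter₂.1 hkk' i h) hi
    exact hjoin i k ⟨hk, hki⟩ k' ⟨hk', hi⟩
  set G : Set X := ⋃ k ∈ {k ∈ K | JoinedIn F a k}, N k with hG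
  set G' : Set X := ⋃ k ∈ {k ∈ K | ¬ JoinedIn F a k}, N k with hG'
  have hGo : IsOpen G := isOpen_biUnion fun k _ => hNo k
  have hG'o : IsOpen G' := isOpen_biUnion fun k _ => hNo k
  have hKGG' : K ⊆ G ∪ G' := fun k hk => by
    by_cases h : JoinedIn F a k
    · exact Or.inl (mem_biUnion (show k ∈ {k ∈ K | JoinedIn F a k} from ⟨hk, h⟩) (hkN k))
    · exact Or.inr (mem_biUnion (show k ∈ {k ∈ K | ¬ JoinedIn F a k} from ⟨hk, h⟩) (hkN k))
  have haG : (K ∩ G).Nonempty :=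
    ⟨a, ha, mem_biUnion (show a ∈ {k ∈ K | JoinedIn F a k} from ⟨ha, JoinedIn.refl (hKF ha)⟩)
      (hkN a)⟩
  by_contra hab
  have hbG' : (K ∩ G').Nonempty :=
    ⟨b, hb, mem_biUnion (show b ∈ {k ∈ K | ¬ JoinedIn F a k} from ⟨hb, hab⟩) (hkN b)⟩
  obtain ⟨k, hk, hkG, hkG'⟩ := hK G G' hGo hG'o hKGG' haG hbG'
  obtain ⟨k₁, ⟨hk₁, h₁⟩, hk₁N⟩ := mem_iUnion₂.1 hkG
  obtain ⟨k₂, ⟨hk₂, h₂⟩, hk₂N⟩ := mem_iUnion₂.1 hkG'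
  exact h₂ ((h₁.trans (hjoinN k₁ hk₁ k hk hk₁N)).trans (hjoinN k₂ hk₂ k hk hk₂N).symm)

/-! ### The affine parameter of a segment; connected subsets of a segment are sub-segments -/

/-- The affine parameter of the segment `[p, q]`: `f (p + t (q - p)) = t` (for `p ≠ q`).
[folklore] -/
def segParam (p q : ℂ) (z : ℂ) : ℝ := ((z - p) * conj (q - p)).re / Complex.normSq (q - p)

/-- The affine parameter is continuous. [folklore] -/
theorem continuous_segParam (p q : ℂ) : Continuous (segParam p q) := by
  unfold segParam; fun_prop

/-- The affine parameter recovers the parameter of `lineMap`. [folklore] -/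
theorem segParam_lineMap {p q : ℂ} (hpq : p ≠ q) (t : ℝ) :
    segParam p q (AffineMap.lineMap p q t) = t := by
  have hn : Complex.normSq (q - p) ≠ 0 := by
    rw [Ne, Complex.normSq_eq_zero, sub_eq_zero]; exact fun h => hpq h.symm
  rw [segParam, AffineMap.lineMap_apply_module', div_eq_iff hn]
  simp only [add_sub_cancel_right, Complex.real_smul, mul_assoc, Complex.mul_conj, Complex.re_ofReal_mul,
    Complex.ofReal_re]

/-- The affine parameter is affine along convex combinations. [folklore] -/
theorem segParam_combo (p q u v : ℂ) {a b : ℝ} (hab : a + b = 1) :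
    segParam p q (a • u + b • v) = a * segParam p q u + b * segParam p q v := by
  simp only [segParam]
  rw [mul_div_assoc', mul_div_assoc', ← add_div]
  congr 1
  have e : a • u + b • v - p = a • (u - p) + b • (v - p) := by
    rw [smul_sub, smul_sub, ← add_sub_add_comm, ← add_smul, hab, one_smul]
  rw [e, add_mul, Complex.add_re, Complex.real_smul, Complex.real_smul, mul_assoc, mul_assoc,
    Complex.re_ofReal_mul, Complex.re_ofReal_mul]

/-- A point of the segment is `lineMap` of its parameter. [folklore] -/
theorem lineMap_segParam {p q z : ℂ} (hpq : p ≠ q) (hz : z ∈ segment ℝ p q) :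
    AffineMap.lineMap p q (segParam p q z) = z := by
  rw [segment_eq_image_lineMap] at hz
  obtain ⟨t, -, rfl⟩ := hz
  rw [segParam_lineMap hpq]

/-- The parameter of a point of the segment lies in `[0, 1]`. [folklore] -/
theorem segParam_mem_Icc {p q z : ℂ} (hpq : p ≠ q) (hz : z ∈ segment ℝ p q) :
    segParam p q z ∈ Icc (0 : ℝ) 1 := by
  rw [segment_eq_image_lineMap] at hz
  obtain ⟨t, ht, rfl⟩ := hz
  rwa [segParam_lineMap hpq]

/-- **A preconnected subset of a segment contains the segment between any two of its points.**
[folklore] -/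
theorem segment_subset_of_isPreconnected_subset_segment {p q : ℂ} {K : Set ℂ}
    (hK : IsPreconnected K) (hKs : K ⊆ segment ℝ p q) {u v : ℂ} (hu : u ∈ K) (hv : v ∈ K) :
    segment ℝ u v ⊆ K := by
  by_cases hpq : p = q
  · subst hpq
    rw [segment_same] at hKs
    have hu' := hKs hu; have hv' := hKs hv
    rw [mem_singleton_iff] at hu' hv'
    subst hu' hv'
    rw [segment_same]; exact singleton_subset_iff.2 hu
  intro w hw
  -- the parameter of `w` lies between those of `u` and `v`, hence is attained on `K`
  set f := segParam p q with hf
  have hS : (f '' K).OrdConnected := (hK.image f (continuous_segParam p q).continuousOn).ordConnected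
  have hwuv : f w ∈ uIcc (f u) (f v) := by
    obtain ⟨a, b, ha, hb, hab, rfl⟩ := hw
    rw [hf, segParam_combo p q u v hab, ← segment_eq_uIcc]
    exact ⟨a, b, ha, hb, hab, rfl⟩
  obtain ⟨k, hk, hkw⟩ := hS.uIcc_subset (mem_image_of_mem f hu) (mem_image_of_mem f hv) hwuv
  have hwseg : w ∈ segment ℝ p q := (convex_segment p q).segment_subset (hKs hu) (hKs hv) hw
  have : k = w := by
    rw [← lineMap_segParam hpq (hKs hk), ← lineMap_segParam hpq hwseg]
    exact congrArg _ hkw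
  rw [← this]; exact hk

/-! ### Lattice segments at mesh `δ` -/

/-- The drawn segment of `{x, y}` at mesh `δ` is the `δ`-scaled unit trace: `z ∈ [δx, δy]` iff
`δ⁻¹ z ∈ edgeTrace s(x, y)` (`δ ≠ 0`). [folklore] -/
theorem mem_segment_meshPoint_iff {δ : ℝ} (hδ : δ ≠ 0) {x y : Site 2} {z : ℂ} :
    z ∈ segment ℝ (meshPoint δ x) (meshPoint δ y) ↔ (δ : ℂ)⁻¹ * z ∈ edgeTrace s(x, y) := by
  have hδ' : (δ : ℂ) ≠ 0 := Complex.ofReal_ne_zero.2 hδ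
  rw [edgeTrace_mk, segment_eq_image_lineMap, segment_eq_image_lineMap]
  constructor
  · rintro ⟨t, ht, rfl⟩
    refine ⟨t, ht, ?_⟩
    simp only [AffineMap.lineMap_apply_module', meshPoint, Complex.real_smul]
    field_simp
  · rintro ⟨t, ht, h⟩
    refine ⟨t, ht, ?_⟩
    have : z = (δ : ℂ) * (AffineMap.lineMap (Site.toComplex x) (Site.toComplex y) t) := by
      rw [h, ← mul_assoc, mul_inv_cancel₀ hδ', one_mul]
    rw [this]
    simp only [AffineMap.lineMap_apply_module', meshPoint, Complex.real_smul]
    ring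

/-- **Distinct lattice edges drawn at mesh `δ ≠ 0` meet only at a common end**: a point on the
segments of two distinct edges `{x, y} ≠ {x', y'}` of `ℤ²` is `δv` for a lattice point `v`
belonging to both edges. [folklore] -/
theorem exists_eq_meshPoint_of_mem_segment_inter {δ : ℝ} (hδ : δ ≠ 0) {x y x' y' : Site 2}
    (hxy : (zdGraph 2).Adj x y) (hxy' : (zdGraph 2).Adj x' y') (hne : s(x, y) ≠ s(x', y')) {z : ℂ}
    (hz : z ∈ segment ℝ (meshPoint δ x) (meshPoint δ y))
    (hz' : z ∈ segment ℝ (meshPoint δ x') (meshPoint δ y')) :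
    ∃ v : Site 2, z = meshPoint δ v ∧ v ∈ s(x, y) ∧ v ∈ s(x', y') := by
  rw [mem_segment_meshPoint_iff hδ] at hz hz'
  obtain ⟨v, hv, hve, hve'⟩ := exists_eq_toComplex_of_mem_edgeTrace_inter
    ((zdGraph 2).mem_edgeSet.2 hxy) ((zdGraph 2).mem_edgeSet.2 hxy') hne hz hz'
  refine ⟨v, ?_, hve, hve'⟩
  have hδ' : (δ : ℂ) ≠ 0 := Complex.ofReal_ne_zero.2 hδ
  rw [meshPoint, ← hv, ← mul_assoc, mul_inv_cancel₀ hδ', one_mul]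

/-! ### The open edges drawn through a compact set -/

section EdgePairs

variable (δ : ℝ) (ω : BondConfig (Site 2)) (K : Set ℂ)

/-- The (ordered) open lattice edges whose drawn segment at mesh `δ` meets `K`. [folklore] -/
def edgePairs : Set (Site 2 × Site 2) :=
  {p | (zdGraph 2).Adj p.1 p.2 ∧ s(p.1, p.2) ∈ ω ∧
    (segment ℝ (meshPoint δ p.1) (meshPoint δ p.2) ∩ K).Nonempty}

variable {δ ω K}

/-- Membership in `edgePairs`, unfolded. [folklore] -/
theorem mem_edgePairs_iff {p : Site 2 × Site 2} : p ∈ edgePairs δ ω K ↔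
    (zdGraph 2).Adj p.1 p.2 ∧ s(p.1, p.2) ∈ ω ∧
      (segment ℝ (meshPoint δ p.1) (meshPoint δ p.2) ∩ K).Nonempty := Iff.rfl

/-- `edgePairs` is symmetric under reversing the edge. [folklore] -/
theorem swap_mem_edgePairs {p : Site 2 × Site 2} (hp : p ∈ edgePairs δ ω K) :
    p.swap ∈ edgePairs δ ω K := by
  obtain ⟨h1, h2, h3⟩ := hp
  exact ⟨h1.symm, by rw [Prod.fst_swap, Prod.snd_swap, Sym2.eq_swap]; exact h2,
    by rw [Prod.fst_swap, Prod.snd_swap, segment_symm]; exact h3⟩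

/-- For bounded `K` and `δ > 0` only finitely many open edges are drawn through `K`. [folklore] -/
theorem edgePairs_finite (hK : Bornology.IsBounded K) (hδ : 0 < δ) : (edgePairs δ ω K).Finite := by
  have hVfin : (meshVertices (cthickening δ K) δ).Finite := meshVertices_finite hK.cthickening hδ
  refine (hVfin.prod hVfin).subset ?_
  have hmem : ∀ x y : Site 2, (zdGraph 2).Adj x y →
      ∀ z ∈ segment ℝ (meshPoint δ x) (meshPoint δ y), z ∈ K →
        x ∈ meshVertices (cthickening δ K) δ := fun x y hxy z hzs hzK => by
    rw [mem_meshVertices_iff]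
    refine mem_cthickening_of_dist_le _ z _ _ hzK ?_
    rw [dist_comm, dist_eq_norm]
    exact (norm_sub_le_of_mem_segment hzs).trans
      ((norm_meshPoint_sub_meshPoint_le_of_adj δ hxy).trans (abs_of_pos hδ).le)
  rintro ⟨x, y⟩ ⟨hxy, -, z, hzs, hzK⟩
  exact ⟨hmem x y hxy z hzs hzK, hmem y x hxy.symm z (by rwa [segment_symm]) hzK⟩

/-- Every point of a set `K` inside the drawn open edges lies on the segment of an edge pair of
`K`. [folklore] -/
theorem exists_mem_edgePairs_of_mem (hKO : K ⊆ openEdgeUnion δ ω) {k : ℂ} (hk : k ∈ K) :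
    ∃ p ∈ edgePairs δ ω K, k ∈ segment ℝ (meshPoint δ p.1) (meshPoint δ p.2) := by
  obtain ⟨x, y, hxy, hω, hkz⟩ := mem_openEdgeUnion_iff.1 (hKO hk)
  exact ⟨(x, y), ⟨hxy, hω, k, hkz, hk⟩, hkz⟩

/-- A point on the drawn segments of two distinct open edges is one of the two drawn ends of the
first. [folklore] -/
theorem eq_endpoint_of_mem_segment_of_mem_segment (hδ : δ ≠ 0) {x y x' y' : Site 2}
    (hxy : (zdGraph 2).Adj x y) (hxy' : (zdGraph 2).Adj x' y') (hne : s(x, y) ≠ s(x', y'))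
    {z : ℂ} (hz : z ∈ segment ℝ (meshPoint δ x) (meshPoint δ y))
    (hz' : z ∈ segment ℝ (meshPoint δ x') (meshPoint δ y')) :
    z = meshPoint δ x ∨ z = meshPoint δ y := by
  obtain ⟨v, rfl, hv, -⟩ := exists_eq_meshPoint_of_mem_segment_inter hδ hxy hxy' hne hz hz'
  rcases Sym2.mem_iff.1 hv with rfl | rfl
  · exact Or.inl rfl
  · exact Or.inr rfl

end EdgePairs

variable {δ : ℝ} {ω : BondConfig (Site 2)} {K : Set ℂ}

/-! ### Anchoring: a connected set through the interior of a drawn edge reaches one of its ends -/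

/-- Closed segments of `ℂ` are compact. [folklore] -/
theorem isCompact_segment_complex (x y : ℂ) : IsCompact (segment ℝ x y) := by
  rw [segment_eq_image_lineMap]
  exact isCompact_Icc.image AffineMap.lineMap_continuous

/-- Two adjacent lattice points are drawn at distinct points (`δ ≠ 0`). [folklore] -/
theorem meshPoint_ne_of_adj (hδ : δ ≠ 0) {x y : Site 2} (h : (zdGraph 2).Adj x y) :
    meshPoint δ x ≠ meshPoint δ y := by
  intro he
  apply h.ne
  have h0 := congrArg Complex.re he
  have h1 := congrArg Complex.im he
  rw [meshPoint_re, meshPoint_re] at h0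
  rw [meshPoint_im, meshPoint_im] at h1
  have e0 : (x 0 : ℝ) = y 0 := mul_left_cancel₀ hδ h0
  have e1 : (x 1 : ℝ) = y 1 := mul_left_cancel₀ hδ h1
  funext i
  fin_cases i
  · exact_mod_cast e0
  · exact_mod_cast e1

/-- **Anchoring dichotomy.** Let `K` be a closed preconnected subset of the drawn open edges of
`ω` (mesh `δ > 0`) and `k ∈ K` an interior point of the drawn open edge `[δa, δb]`. If `K` is
not contained in the open segment `(δa, δb)`, then `K` contains `[δa, k]` or `[k, δb]`: otherwise
points `y₁ ∈ [δa, k] ∖ K`, `y₂ ∈ [k, δb] ∖ K` cut `K` into the part strictly between them (open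
in `K`: off the finitely many other edges through `K` and off the ends) and the rest, both
nonempty. [folklore] -/
theorem segment_subset_or_segment_subset (hδ : 0 < δ) (hK : IsPreconnected K) (hKb : Bornology.IsBounded K)
    (hKO : K ⊆ openEdgeUnion δ ω) {a b : Site 2} (hab : (zdGraph 2).Adj a b)
    {k : ℂ} (hk : k ∈ K) (hkseg : k ∈ segment ℝ (meshPoint δ a) (meshPoint δ b))
    (hka : k ≠ meshPoint δ a) (hkb : k ≠ meshPoint δ b)
    (hnot : ¬ K ⊆ openSegment ℝ (meshPoint δ a) (meshPoint δ b)) :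
    segment ℝ (meshPoint δ a) k ⊆ K ∨ segment ℝ k (meshPoint δ b) ⊆ K := by
  by_contra hcon
  push Not at hcon
  obtain ⟨h₁, h₂⟩ := hcon
  obtain ⟨y₁, hy₁, hy₁K⟩ := not_subset.1 h₁
  obtain ⟨y₂, hy₂, hy₂K⟩ := not_subset.1 h₂
  set Pa := meshPoint δ a with hPa
  set Pb := meshPoint δ b with hPb
  have hPab : Pa ≠ Pb := meshPoint_ne_of_adj hδ.ne' hab
  set f := segParam Pa Pb with hf
  have hfa : f Pa = 0 := by simpa using segParam_lineMap hPab 0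
  have hfb : f Pb = 1 := by simpa using segParam_lineMap hPab 1
  -- sub-segments of `[Pa, Pb]`
  have hsub₁ : segment ℝ Pa k ⊆ segment ℝ Pa Pb :=
    (convex_segment Pa Pb).segment_subset (left_mem_segment ℝ Pa Pb) hkseg
  have hsub₂ : segment ℝ k Pb ⊆ segment ℝ Pa Pb :=
    (convex_segment Pa Pb).segment_subset hkseg (right_mem_segment ℝ Pa Pb)
  have hinj : ∀ z ∈ segment ℝ Pa Pb, ∀ z' ∈ segment ℝ Pa Pb, f z = f z' → z = z' :=
    fun z hz z' hz' h => by rw [← lineMap_segParam hPab hz, ← lineMap_segParam hPab hz', ← hf, h]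
  -- parameters
  set t₀ := f k with ht₀
  set t₁ := f y₁ with ht₁
  set t₂ := f y₂ with ht₂
  have ht₀I := segParam_mem_Icc hPab hkseg
  have ht₀0 : 0 < t₀ := lt_of_le_of_ne ht₀I.1 fun h =>
    hka (hinj k hkseg Pa (left_mem_segment ℝ Pa Pb) (by rw [← ht₀, ← h, hfa]))
  have ht₀1 : t₀ < 1 := lt_of_le_of_ne ht₀I.2 fun h =>
    hkb (hinj k hkseg Pb (right_mem_segment ℝ Pa Pb) (by rw [← ht₀, h, hfb]))
  have ht₁le : 0 ≤ t₁ ∧ t₁ < t₀ := by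
    obtain ⟨α, β, hα, hβ, hαβ, rfl⟩ := hy₁
    have e : f (α • Pa + β • k) = β * t₀ := by
      rw [hf, segParam_combo Pa Pb Pa k hαβ, ← hf, hfa, mul_zero, zero_add]
    refine ⟨by rw [ht₁, e]; exact mul_nonneg hβ ht₀0.le, lt_of_le_of_ne ?_ fun h => ?_⟩
    · rw [ht₁, e]; nlinarith
    · have hyk : α • Pa + β • k = k := hinj _ (hsub₁ ⟨α, β, hα, hβ, hαβ, rfl⟩) k hkseg h
      exact hy₁K (by rw [hyk]; exact hk)
  have ht₂le : t₀ < t₂ ∧ t₂ ≤ 1 := by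
    obtain ⟨α, β, hα, hβ, hαβ, rfl⟩ := hy₂
    have e : f (α • k + β • Pb) = α * t₀ + β := by
      rw [hf, segParam_combo Pa Pb k Pb hαβ, ← hf, hfb, mul_one]
    refine ⟨lt_of_le_of_ne ?_ fun h => ?_, by rw [ht₂, e]; nlinarith⟩
    · rw [ht₂, e]; nlinarith
    · have hyk : α • k + β • Pb = k := hinj _ (hsub₂ ⟨α, β, hα, hβ, hαβ, rfl⟩) k hkseg h.symm
      exact hy₂K (by rw [hyk]; exact hk)
  -- an open set `W` seeing, inside `K`, exactly the interior points of `[Pa, Pb]`: the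
  -- complement of the finitely many other open edges through `K` and of the two ends
  obtain ⟨W, hWo, hKW, hWmem⟩ : ∃ W : Set ℂ, IsOpen W ∧
      (∀ z ∈ K, z ∈ W → z ∈ segment ℝ Pa Pb) ∧
      (∀ z ∈ segment ℝ Pa Pb, z ≠ Pa → z ≠ Pb → z ∈ W) := by
    have hfin : {p ∈ edgePairs δ ω K | s(p.1, p.2) ≠ s(a, b)}.Finite :=
      (edgePairs_finite hKb hδ).subset (sep_subset _ _)
    refine ⟨(⋃ p ∈ {p ∈ edgePairs δ ω K | s(p.1, p.2) ≠ s(a, b)},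
        segment ℝ (meshPoint δ p.1) (meshPoint δ p.2))ᶜ ∩ {Pa, Pb}ᶜ, ?_, ?_, ?_⟩
    · refine IsOpen.inter ?_ (Set.toFinite _).isClosed.isOpen_compl
      rw [isOpen_compl_iff]
      exact hfin.isClosed_biUnion fun p _ => (isCompact_segment_complex _ _).isClosed
    · rintro z hz ⟨hzU, -⟩
      obtain ⟨p, hp, hzp⟩ := exists_mem_edgePairs_of_mem hKO hz
      by_cases hpe : s(p.1, p.2) = s(a, b)
      · rcases Sym2.eq_iff.1 hpe with ⟨h1, h2⟩ | ⟨h1, h2⟩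
        · rwa [h1, h2] at hzp
        · rw [h1, h2, segment_symm] at hzp; exact hzp
      · have hp' : p ∈ {p ∈ edgePairs δ ω K | s(p.1, p.2) ≠ s(a, b)} := ⟨hp, hpe⟩
        exact absurd (mem_biUnion hp' hzp) hzU
    · intro z hz hza hzb
      refine ⟨fun hzU => ?_, ?_⟩
      · obtain ⟨p, hp, hzp⟩ := mem_iUnion₂.1 hzU
        rcases eq_endpoint_of_mem_segment_of_mem_segment (x := a) (y := b) (x' := p.1) (y' := p.2)
          hδ.ne' hab hp.1.1 (Ne.symm hp.2) hz hzp with h | h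
        · exact hza h
        · exact hzb h
      · rw [mem_compl_iff, mem_insert_iff, mem_singleton_iff, not_or]
        exact ⟨hza, hzb⟩
  -- parameters in `(t₁, t₂)` are interior
  have hWmem' : ∀ z ∈ segment ℝ Pa Pb, f z ∈ Ioo t₁ t₂ → z ∈ W := by
    intro z hz hfz
    refine hWmem z hz (fun h => ?_) (fun h => ?_)
    · rw [h, hfa] at hfz; exact absurd hfz.1 (not_lt.2 ht₁le.1)
    · rw [h, hfb] at hfz; exact absurd hfz.2 (not_lt.2 ht₂le.2)
  set G : Set ℂ := W ∩ f ⁻¹' Ioo t₁ t₂ with hG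
  have hGo : IsOpen G := hWo.inter ((continuous_segParam Pa Pb).isOpen_preimage _ isOpen_Ioo)
  set G' : Set ℂ := (segment ℝ Pa Pb ∩ f ⁻¹' Icc t₁ t₂)ᶜ with hG'
  have hG'o : IsOpen G' :=
    ((isCompact_segment_complex Pa Pb).isClosed.inter (isClosed_Icc.preimage (continuous_segParam Pa Pb))).isOpen_compl
  have hcover : K ⊆ G ∪ G' := by
    intro z hz
    by_cases hzG' : z ∈ G'
    · exact Or.inr hzG'
    · left
      simp only [hG', mem_compl_iff, not_not, mem_inter_iff, mem_preimage] at hzG'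
      obtain ⟨hzs, hfz1, hfz2⟩ := hzG'
      have hfz : f z ∈ Ioo t₁ t₂ := by
        refine ⟨lt_of_le_of_ne hfz1 fun h => hy₁K ?_, lt_of_le_of_ne hfz2 fun h => hy₂K ?_⟩
        · rwa [hinj y₁ (hsub₁ hy₁) z hzs (by rw [← ht₁, h])]
        · rwa [← hinj z hzs y₂ (hsub₂ hy₂) (by rw [← ht₂, h])]
      exact ⟨hWmem' z hzs hfz, hfz⟩
  have hdisj : ∀ z ∈ K, z ∈ G → z ∉ G' := by
    intro z hz hzG hzG'
    apply hzG'
    exact ⟨hKW z hz hzG.1, Ioo_subset_Icc_self hzG.2⟩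
  have hkG : k ∈ K ∩ G := ⟨hk, hWmem' k hkseg ⟨ht₁le.2, ht₂le.1⟩, ⟨ht₁le.2, ht₂le.1⟩⟩
  -- a point of `K` off the open segment lies in `G'`
  obtain ⟨z, hzK, hzopen⟩ := not_subset.1 hnot
  have hzG' : z ∈ G' := by
    intro hz
    obtain ⟨hzs, hfz1, hfz2⟩ := hz
    apply hzopen
    rw [openSegment_eq_image_lineMap]
    refine ⟨f z, ⟨lt_of_le_of_ne (ht₁le.1.trans hfz1) fun h => ?_,
      lt_of_le_of_ne (hfz2.trans ht₂le.2) fun h => ?_⟩, lineMap_segParam hPab hzs⟩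
    · -- `f z = 0` forces `t₁ = 0`, `y₁ = Pa = z ∈ K`
      have ht₁0 : t₁ = 0 := le_antisymm (h ▸ hfz1) ht₁le.1
      have hy₁a : y₁ = Pa := hinj y₁ (hsub₁ hy₁) Pa (left_mem_segment ℝ Pa Pb) (by rw [← ht₁, ht₁0, hfa])
      have hza : z = Pa := hinj z hzs Pa (left_mem_segment ℝ Pa Pb) (by rw [← h, hfa])
      exact hy₁K (by rwa [hy₁a, ← hza])
    · have ht₂1 : t₂ = 1 := le_antisymm ht₂le.2 (h ▸ hfz2)
      have hy₂b : y₂ = Pb := hinj y₂ (hsub₂ hy₂) Pb (right_mem_segment ℝ Pa Pb) (by rw [← ht₂, ht₂1, hfb])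
      have hzb : z = Pb := hinj z hzs Pb (right_mem_segment ℝ Pa Pb) (by rw [h, hfb])
      exact hy₂K (by rwa [hy₂b, ← hzb])
  obtain ⟨w, hwK, hwG, hwG'⟩ := hK G G' hGo hG'o hcover ⟨k, hkG⟩ ⟨z, hzK, hzG'⟩
  exact hdisj w hwK hwG hwG'

/-! ### Connected crossings inside the drawn open edges are path crossings -/

/-- The set of points `z` with `[a, z] ⊆ K` is closed when `K` is. [folklore] -/
theorem isClosed_setOf_segment_subset {K : Set ℂ} (hK : IsClosed K) (a : ℂ) :
    IsClosed {z : ℂ | segment ℝ a z ⊆ K} := by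
  have e : {z : ℂ | segment ℝ a z ⊆ K} = ⋂ t ∈ Icc (0 : ℝ) 1, (fun z => AffineMap.lineMap a z t) ⁻¹' K := by
    ext z
    simp only [segment_eq_image_lineMap, image_subset_iff, mem_setOf_eq, mem_iInter, mem_preimage]
    rfl
  rw [e]
  refine isClosed_biInter fun t _ => hK.preimage ?_
  simp only [AffineMap.lineMap_apply_module']
  fun_prop

/-- **Connected crossings are path crossings in the discrete setting** (Schramm–Smirnov 2011,
§1.3: "in the discrete setting there is no difference between connected and path-connected
crossings"). If `K` is a compact connected set contained in the drawn open edges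
`openEdgeUnion δ ω` of `δℤ²` (`δ > 0`) and in a set `C`, then any two points of `K` are joined by
a path inside `C ∩ openEdgeUnion δ ω`. Proof: either `K` lies inside one open edge segment (then
it contains the segment between the two points), or every point of `K` on a drawn open edge is
joined inside `K` along that edge to one of its two ends (`segment_subset_or_segment_subset`); the
finitely many closed pieces `{z ∈ [δx, δy] : [δx, z] ⊆ K}` then cover `K`, each is joined through
its end `δx`, and one chains along the cover (`joinedIn_of_finite_closed_cover`).
[cite: SchrammSmirnov2011, §1.3] -/
theorem joinedIn_inter_openEdgeUnion_of_isConnected (hδ : 0 < δ) {C K : Set ℂ} (hKc : IsCompact K)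
    (hK : IsConnected K) (hKO : K ⊆ openEdgeUnion δ ω) (hKC : K ⊆ C) {a b : ℂ} (ha : a ∈ K)
    (hb : b ∈ K) : JoinedIn (C ∩ openEdgeUnion δ ω) a b := by
  have hKF : K ⊆ C ∩ openEdgeUnion δ ω := subset_inter hKC hKO
  by_cases hA : ∃ p ∈ edgePairs δ ω K, K ⊆ openSegment ℝ (meshPoint δ p.1) (meshPoint δ p.2)
  · -- `K` inside one open edge: it contains `[a, b]`
    obtain ⟨p, -, hKp⟩ := hA
    exact JoinedIn.of_segment_subset ((segment_subset_of_isPreconnected_subset_segment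
      hK.isPreconnected (hKp.trans (openSegment_subset_segment ℝ _ _)) ha hb).trans hKF)
  push Not at hA
  haveI : Finite (edgePairs δ ω K) := (edgePairs_finite hKc.isBounded hδ).to_subtype
  refine joinedIn_of_finite_closed_cover hK.isPreconnected
    (fun p : edgePairs δ ω K => segment ℝ (meshPoint δ p.1.1) (meshPoint δ p.1.2) ∩
      {z | segment ℝ (meshPoint δ p.1.1) z ⊆ K})
    (fun p => (isCompact_segment_complex _ _).isClosed.inter (isClosed_setOf_segment_subset hKc.isClosed _))
    (fun k hk => ?_) hKF (fun p x hx y hy => ?_) ha hb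
  · -- cover
    obtain ⟨p, hp, hkp⟩ := exists_mem_edgePairs_of_mem hKO hk
    rw [mem_iUnion]
    by_cases hka : k = meshPoint δ p.1
    · refine ⟨⟨p, hp⟩, hkp, ?_⟩
      show segment ℝ (meshPoint δ p.1) k ⊆ K
      rw [← hka, segment_same]; exact singleton_subset_iff.2 hk
    by_cases hkb : k = meshPoint δ p.2
    · refine ⟨⟨p.swap, swap_mem_edgePairs hp⟩, by rw [Prod.fst_swap, Prod.snd_swap, segment_symm]; exact hkp, ?_⟩
      show segment ℝ (meshPoint δ p.swap.1) k ⊆ K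
      rw [Prod.fst_swap, ← hkb, segment_same]; exact singleton_subset_iff.2 hk
    rcases segment_subset_or_segment_subset hδ hK.isPreconnected hKc.isBounded hKO hp.1 hk hkp hka hkb
      (hA p hp) with h | h
    · exact ⟨⟨p, hp⟩, hkp, h⟩
    · refine ⟨⟨p.swap, swap_mem_edgePairs hp⟩, by rw [Prod.fst_swap, Prod.snd_swap, segment_symm]; exact hkp, ?_⟩
      show segment ℝ (meshPoint δ p.swap.1) k ⊆ K
      rw [Prod.fst_swap, segment_symm]; exact h
  · -- pieces are joined through their anchor
    exact (JoinedIn.of_segment_subset (hx.2.2.trans hKF)).symm.trans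
      (JoinedIn.of_segment_subset (hy.2.2.trans hKF))

/-! ### Bridge: the crossing event of a conformal rectangle and the crossing events of `ℋ_ℂ` -/

open QuadCrossing

variable {R : ConformalRectangle} {Q : Quad (univ : Set ℂ)}

/-- **A crossing of `R` by an open path makes the quad of `R` crossed in `S_ω`.** If the quad
`Q ∈ 𝒬_ℂ` has carrier the closed quad of `R` and sides `0`, `2` its arcs `0`, `2`, then
`𝒞_δ(R) ⊆ {ω : Q ∈ S_ω}` (the range of the crossing path is a connected compact crossing of `Q`
inside the drawn open edges). [cite: SchrammSmirnov2011, §1.3] -/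
theorem quadCrossing_subset_setOf_mem_z2QuadConfig (hc : Q.carrier = closure R.carrier)
    (h0 : Q.side 0 = R.arc 0) (h2 : Q.side 2 = R.arc 2) (δ : ℝ) :
    quadCrossing R δ ⊆ {ω | Q ∈ z2QuadConfig univ δ ω} := by
  rintro ω ⟨a, ha, b, hb, γ, hγ⟩
  refine mem_z2QuadConfig_of_isCrossing (K := range γ) ⟨isCompact_range γ.continuous,
    isConnected_range γ.continuous, ?_, ?_, ?_⟩ ?_
  · rw [hc]; rintro _ ⟨t, rfl⟩; exact (hγ t).1
  · rw [h0]; exact ⟨a, ⟨0, γ.source⟩, ha⟩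
  · rw [h2]; exact ⟨b, ⟨1, γ.target⟩, hb⟩
  · rintro _ ⟨t, rfl⟩; exact (hγ t).2

/-- **Conversely, up to a perturbation**: if moreover `Q < Q₁` in Schramm–Smirnov's order, then
`{ω : Q₁ ∈ S_ω} ⊆ 𝒞_δ(R)` for `δ > 0` — `Q₁ ∈ S_ω` (a limit of crossed quads) forces a connected
compact crossing of `Q` inside the drawn open edges (`Quad.exists_isCrossing_of_mem_closure`),
which is a path crossing (`joinedIn_inter_openEdgeUnion_of_isConnected`).
[cite: SchrammSmirnov2011, §1.3] -/
theorem setOf_mem_z2QuadConfig_subset_quadCrossing (hc : Q.carrier = closure R.carrier)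
    (h0 : Q.side 0 = R.arc 0) (h2 : Q.side 2 = R.arc 2) {Q₁ : Quad (univ : Set ℂ)}
    (hQ : Q.StrictlyDominated Q₁) (hδ : 0 < δ) :
    {ω | Q₁ ∈ z2QuadConfig univ δ ω} ⊆ quadCrossing R δ := by
  intro ω hω
  have hω' : Q₁ ∈ (z2QuadConfig univ δ ω : Set (Quad (univ : Set ℂ))) := hω
  rw [coe_z2QuadConfig] at hω'
  obtain ⟨K, ⟨hKc, hKconn, hKQ, ⟨a, haK, ha⟩, ⟨b, hbK, hb⟩⟩, hKO⟩ :=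
    Quad.exists_isCrossing_of_mem_closure hQ hω'
  refine ⟨a, h0 ▸ ha, b, h2 ▸ hb, ?_⟩
  rw [← hc]
  exact joinedIn_inter_openEdgeUnion_of_isConnected hδ hKc hKconn hKO hKQ haK hbK

/-! ### The rotated lattice -/

/-- `z ↦ e^{-iα} z` is the inverse of the rotation homeomorphism `z ↦ e^{iα} z`. [folklore] -/
theorem rotation_exp_neg_eq_symm (α : ℝ) :
    (fun z : ℂ => rotation (Circle.exp (-α)) z) = ⇑(rotation (Circle.exp α)).toHomeomorph.symm := by
  funext z
  rw [Circle.exp_neg, ← rotation_symm]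
  rfl

/-- The quad data of `R` transported by `e^{-iα}`: the carrier of `e^{-iα} ∘ Q` is the closed quad
of `e^{-iα} R`. [folklore] -/
theorem carrier_mapHomeomorph_rotation_symm (hc : Q.carrier = closure R.carrier) (α : ℝ) :
    (Q.mapHomeomorph (rotation (Circle.exp α)).toHomeomorph.symm).carrier =
      closure (rotateQuad (-α) R).carrier := by
  rw [Quad.carrier_mapHomeomorph, hc, carrier_rotateQuad, rotation_exp_neg_eq_symm,
    Homeomorph.image_closure]

/-- The quad data of `R` transported by `e^{-iα}`: sides go to arcs. [folklore] -/
theorem side_mapHomeomorph_rotation_symm {k : Fin 4} (hk : Q.side k = R.arc k) (α : ℝ) :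
    (Q.mapHomeomorph (rotation (Circle.exp α)).toHomeomorph.symm).side k =
      (rotateQuad (-α) R).arc k := by
  rw [Quad.side_mapHomeomorph, hk, arc_rotateQuad, rotation_exp_neg_eq_symm]

/-- Membership in a rotated configuration: `Q ∈ e^{iα} · S ↔ e^{-iα} ∘ Q ∈ S`. [folklore] -/
theorem mem_quadConfigRotate_iff {α : ℝ} {S : QuadConfig (univ : Set ℂ)} {Q' : Quad (univ : Set ℂ)} :
    Q' ∈ QuadConfig.rotate α S ↔ Q'.mapHomeomorph (rotation (Circle.exp α)).toHomeomorph.symm ∈ S :=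
  QuadConfig.mem_mapHomeomorph _

/-- **The rotated lattice, first inclusion**: `ω` crosses `e^{-iα}R` at mesh `δ` — i.e. `ω` drawn
on `e^{iα}δℤ²` crosses `R` — only if the quad `Q` of `R` belongs to the rotated configuration
`e^{iα} · S_ω`. [cite: SchrammSmirnov2011, §1.3] -/
theorem quadCrossing_rotateQuad_neg_subset (hc : Q.carrier = closure R.carrier)
    (h0 : Q.side 0 = R.arc 0) (h2 : Q.side 2 = R.arc 2) (α δ : ℝ) :
    quadCrossing (rotateQuad (-α) R) δ ⊆ {ω | Q ∈ QuadConfig.rotate α (z2QuadConfig univ δ ω)} := by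
  intro ω hω
  rw [mem_setOf_eq, mem_quadConfigRotate_iff]
  exact quadCrossing_subset_setOf_mem_z2QuadConfig (carrier_mapHomeomorph_rotation_symm hc α)
    (side_mapHomeomorph_rotation_symm h0 α) (side_mapHomeomorph_rotation_symm h2 α) δ hω

/-- **The rotated lattice, second inclusion**: if `Q < Q₁` and `Q₁ ∈ e^{iα} · S_ω`, then `ω`
crosses `e^{-iα}R` at mesh `δ > 0`. [cite: SchrammSmirnov2011, §1.3] -/
theorem subset_quadCrossing_rotateQuad_neg (hc : Q.carrier = closure R.carrier)
    (h0 : Q.side 0 = R.arc 0) (h2 : Q.side 2 = R.arc 2) {Q₁ : Quad (univ : Set ℂ)}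
    (hQ : Q.StrictlyDominated Q₁) (α : ℝ) (hδ : 0 < δ) :
    {ω | Q₁ ∈ QuadConfig.rotate α (z2QuadConfig univ δ ω)} ⊆ quadCrossing (rotateQuad (-α) R) δ := by
  intro ω hω
  rw [mem_setOf_eq, mem_quadConfigRotate_iff] at hω
  exact setOf_mem_z2QuadConfig_subset_quadCrossing (carrier_mapHomeomorph_rotation_symm hc α)
    (side_mapHomeomorph_rotation_symm h0 α) (side_mapHomeomorph_rotation_symm h2 α)
    (hQ.mapHomeomorph _) hδ hω

end Literature.Probability.Percolation
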